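import Summits.Ventures.PercRepro.C026C028SureReductionThm
import Summits.Ventures.PercRepro.C026C028Series
import Summits.Ventures.PercRepro.C026C028Parallel

/-!
# The reduction to step (A) at non-marks of degree `≥ 3` (p6, gen 15)

`C028At_of_stepSure` (C026C028SureReductionThm) assumes mine-3's step (A) at every fractional edge from
the sure cluster of `a` to a non-mark `y`.  Two shapes of `y` are free: a pendant `y`
(`C028At_of_pendantCluster`: its sure cluster carries no other non-closed edge) and a `y` of degree two whose other edge is not surely open (`C028At_series_cluster`, the
series reduction — the reduced weight vector has one fractional edge fewer, so the strong induction
supplies C-028(c) for it); so is a weight vector with two parallel fractional edges (`C028At_parallel`).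
`C028StepSure3` is (A) restricted to the remaining configurations — no two fractional edges parallel
(`C028ParallelFree`), and `y` with at least two other edges not surely closed, or one that is surely open —
and **`C028At_of_stepSure3`** derives ROW C-028(c) everywhere from it.
-/

namespace PercRepro

open Finset

namespace MultiGraph

variable {V E : Type*} (G : MultiGraph V E) [Fintype E] [DecidableEq E]

/-- The sure cluster of `y` is pendant at `e`: every other edge touching it is surely open or surely
closed. -/
def C028PendantAt (p : E → ℝ) (e : E) (y : V) : Prop :=
  ∀ e', e' ≠ e → (G.SureConn p y (G.fst e') ∨ G.SureConn p y (G.snd e')) → p e' = 0 ∨ p e' = 1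

/-- The sure cluster of `y` is a series cluster at `e`: exactly one other edge `g` touching it is
neither surely closed nor surely open, every other edge touching it is surely open or closed. -/
def C028SeriesAt (p : E → ℝ) (e : E) (y : V) : Prop :=
  ∃ g, g ≠ e ∧ (G.SureConn p y (G.fst g) ∨ G.SureConn p y (G.snd g)) ∧ p g ≠ 1 ∧
    ∀ e', e' ≠ e → e' ≠ g →
      (G.SureConn p y (G.fst e') ∨ G.SureConn p y (G.snd e')) → p e' = 0 ∨ p e' = 1

/-- No two distinct fractional edges of `p` are parallel. -/
def C028ParallelFree (p : E → ℝ) : Prop :=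
  ∀ e g, e ∈ fracEdges p → g ∈ fracEdges p → e ≠ g →
    ¬ ((G.fst g = G.fst e ∧ G.snd g = G.snd e) ∨ (G.fst g = G.snd e ∧ G.snd g = G.fst e))

/-- **Step (A) at non-marks of degree `≥ 3`** (sure-cluster form): `C028StepSure` restricted to
parallel-free weight vectors and a far end `y` that is neither pendant nor a series vertex at `e`. -/
def C028StepSure3 : Prop :=
  ∀ (p : E → ℝ) (e : E) (a b c y : V), IsProb p → G.C028ParallelFree p → p e ≠ 0 → p e ≠ 1 →
    ((G.SureConn p a (G.fst e) ∧ G.snd e = y) ∨ (G.SureConn p a (G.snd e) ∧ G.fst e = y)) →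
    ¬ G.SureConn p a y → ¬ G.SureConn p b y → ¬ G.SureConn p c y →
    ¬ G.C028PendantAt p e y → ¬ G.C028SeriesAt p e y →
    G.C028Minors p e → G.C028At p a b c

/-- The step at a fractional edge touching the sure cluster of `a`, with the strong induction
hypothesis for every weight vector with fewer fractional edges. -/
theorem C028At_step_sure3 (hA : G.C028StepSure3) {p : E → ℝ} (hp : IsProb p) {e : E}
    (he : e ∈ fracEdges p)
    (ih : ∀ p' : E → ℝ, IsProb p' → (fracEdges p').card < (fracEdges p).card →
      ∀ a b c : V, G.C028At p' a b c)
    {a : V} (hx : G.SureConn p a (G.fst e) ∨ G.SureConn p a (G.snd e)) (b c : V) :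
    G.C028At p a b c := by
  classical
  -- a parallel pair of fractional edges is reduced first
  by_cases hpf : G.C028ParallelFree p
  swap
  · unfold C028ParallelFree at hpf
    obtain ⟨e₁, g₁, he₁, hg₁, hne, hpar⟩ : ∃ e₁ g₁, e₁ ∈ fracEdges p ∧ g₁ ∈ fracEdges p ∧ e₁ ≠ g₁ ∧
        ((G.fst g₁ = G.fst e₁ ∧ G.snd g₁ = G.snd e₁) ∨
          (G.fst g₁ = G.snd e₁ ∧ G.snd g₁ = G.fst e₁)) := by
      by_contra hcon
      exact hpf fun e₁ g₁ he₁ hg₁ hne hpar => hcon ⟨e₁, g₁, he₁, hg₁, hne, hpar⟩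
    have hp' : IsProb (Function.update (Function.update p e₁ 0) g₁ (1 - (1 - p e₁) * (1 - p g₁))) :=
      (hp.update e₁ ⟨le_rfl, zero_le_one⟩).update g₁
        ⟨by nlinarith [(hp e₁).1, (hp e₁).2, (hp g₁).1, (hp g₁).2],
          by nlinarith [(hp e₁).1, (hp e₁).2, (hp g₁).1, (hp g₁).2]⟩
    exact G.C028At_parallel hp hne hpar
      (ih _ hp' (card_fracEdges_parallel_lt hne he₁ hg₁) a b c)
  have he' := he
  simp only [fracEdges, Finset.mem_filter, Finset.mem_univ, true_and] at he'
  obtain ⟨he0, he1⟩ := he'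
  have hIH : G.C028Minors p e :=
    ⟨fun a' b' c' => ih _ (hp.update e ⟨le_rfl, zero_le_one⟩)
        (card_fracEdges_update_lt he (Or.inl rfl)) a' b' c',
      fun a' b' c' => ih _ (hp.update e ⟨zero_le_one, le_rfl⟩)
        (card_fracEdges_update_lt he (Or.inr rfl)) a' b' c'⟩
  have h0 := hIH.1 a b c
  -- the far end `y` and the orientation
  have key : ∀ y : V,
      ((G.SureConn p a (G.fst e) ∧ G.snd e = y) ∨ (G.SureConn p a (G.snd e) ∧ G.fst e = y)) →
      G.C028At p a b c := by
    intro y hor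
    have hye : G.fst e = y ∨ G.snd e = y := by
      rcases hor with ⟨_, h⟩ | ⟨_, h⟩
      · exact Or.inr h
      · exact Or.inl h
    by_cases hay : G.SureConn p a y
    · -- inside the sure cluster of `a`
      have hxy : G.SureConn p (G.fst e) (G.snd e) := by
        rcases hor with ⟨hx', rfl⟩ | ⟨hx', rfl⟩
        · exact Conn.trans (Conn.symm (show G.Conn (sureConfig p) a (G.fst e) from hx')) hay
        · exact Conn.trans (Conn.symm (show G.Conn (sureConfig p) a (G.fst e) from hay)) hx'
      exact G.C028At_of_sureConn_endpoints hp he1 hxy h0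
    by_cases hby : G.SureConn p b y
    · have hs : (G.SureConn p a (G.fst e) ∧ G.SureConn p b (G.snd e)) ∨
          (G.SureConn p a (G.snd e) ∧ G.SureConn p b (G.fst e)) := by
        rcases hor with ⟨hx', rfl⟩ | ⟨hx', rfl⟩
        · exact Or.inl ⟨hx', hby⟩
        · exact Or.inr ⟨hx', hby⟩
      exact G.C028At_of_sureEdge_ab hp he1 hs c h0
    by_cases hcy : G.SureConn p c y
    · have hs : (G.SureConn p a (G.fst e) ∧ G.SureConn p c (G.snd e)) ∨
          (G.SureConn p a (G.snd e) ∧ G.SureConn p c (G.fst e)) := by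
        rcases hor with ⟨hx', rfl⟩ | ⟨hx', rfl⟩
        · exact Or.inl ⟨hx', hcy⟩
        · exact Or.inr ⟨hx', hcy⟩
      exact G.C028At_of_sureEdge_ac hp he1 hs b h0
    -- `y` is a non-mark outside the three sure clusters
    have ha' : a ≠ y := fun h => hay (h ▸ Conn.refl G _ a)
    have hb' : b ≠ y := fun h => hby (h ▸ Conn.refl G _ b)
    have hc' : c ≠ y := fun h => hcy (h ▸ Conn.refl G _ c)
    by_cases hpend : G.C028PendantAt p e y
    · exact G.C028At_of_pendantCluster hp he1 hye hpend
        (fun h => hay (Conn.symm (show G.Conn (sureConfig p) y a from h)))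
        (fun h => hby (Conn.symm (show G.Conn (sureConfig p) y b from h)))
        (fun h => hcy (Conn.symm (show G.Conn (sureConfig p) y c from h))) h0
    by_cases hser : G.C028SeriesAt p e y
    · obtain ⟨g, hge, hyg, hg1, hoth⟩ := hser
      have hp' : IsProb (Function.update (Function.update p e 1) g (p e * p g)) :=
        (hp.update e ⟨zero_le_one, le_rfl⟩).update g
          ⟨mul_nonneg (hp e).1 (hp g).1, mul_le_one₀ (hp e).2 (hp g).1 (hp g).2⟩
      exact G.C028At_series_cluster hp hge.symm he1 hg1 hye hyg hoth
        (fun h => hay (Conn.symm (show G.Conn (sureConfig p) y a from h)))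
        (fun h => hby (Conn.symm (show G.Conn (sureConfig p) y b from h)))
        (fun h => hcy (Conn.symm (show G.Conn (sureConfig p) y c from h)))
        (ih _ hp' (card_fracEdges_series_lt hge.symm he hg1) a b c)
    exact hA p e a b c y hp hpf he0 he1 hor hay hby hcy hpend hser hIH
  rcases hx with hx | hx
  · exact key (G.snd e) (Or.inl ⟨hx, rfl⟩)
  · exact key (G.fst e) (Or.inr ⟨hx, rfl⟩)

/-- **THE REDUCTION TO (A) AT DEGREE `≥ 3`**: `C028StepSure3` gives ROW C-028(c) on every marked
multigraph at every weight vector. -/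
theorem C028At_of_stepSure3 (hA : G.C028StepSure3) :
    ∀ p : E → ℝ, IsProb p → ∀ a b c : V, G.C028At p a b c := by
  suffices H : ∀ n : ℕ, ∀ p : E → ℝ, IsProb p → (fracEdges p).card = n →
      ∀ a b c : V, G.C028At p a b c by
    intro p hp
    exact H _ p hp rfl
  intro n
  refine Nat.strong_induction_on n ?_
  intro n ih p hp hn a b c
  by_cases hF : ∃ e ∈ fracEdges p, G.SureConn p a (G.fst e) ∨ G.SureConn p a (G.snd e)
  · obtain ⟨e, he, hx⟩ := hF
    refine G.C028At_step_sure3 hA hp he (fun p' hp' hlt => ih _ (hn ▸ hlt) p' hp' rfl) hx b c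
  · refine G.C028At_of_no_fracEdge_at_cluster hp (fun e htouch => ?_) b c
    by_contra hcon
    refine hF ⟨e, ?_, htouch⟩
    simp only [fracEdges, Finset.mem_filter, Finset.mem_univ, true_and]
    exact ⟨fun h => hcon (Or.inl h), fun h => hcon (Or.inr h)⟩

/-! ### Variants: the same marking only; a chosen edge (mine-3 §12 (ii)) -/

/-- Step (A) with the induction hypothesis for the SAME marking only (mine-3 §12 (ii)): the minors'
C-028(c) at `(a, b, c)` suffices in the hypothesis. -/
def C028StepSureSame : Prop :=
  ∀ (p : E → ℝ) (e : E) (a b c y : V), IsProb p → G.C028ParallelFree p → p e ≠ 0 → p e ≠ 1 →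
    ((G.SureConn p a (G.fst e) ∧ G.snd e = y) ∨ (G.SureConn p a (G.snd e) ∧ G.fst e = y)) →
    ¬ G.SureConn p a y → ¬ G.SureConn p b y → ¬ G.SureConn p c y →
    ¬ G.C028PendantAt p e y → ¬ G.C028SeriesAt p e y →
    G.C028At (Function.update p e 0) a b c → G.C028At (Function.update p e 1) a b c →
    G.C028At p a b c

/-- The same-marking step implies the all-markings step. -/
theorem C028StepSure3_of_same (h : G.C028StepSureSame) : G.C028StepSure3 :=
  fun p e a b c y hp hpf he0 he1 hor hay hby hcy hpend hser hIH =>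
    h p e a b c y hp hpf he0 he1 hor hay hby hcy hpend hser (hIH.1 a b c) (hIH.2 a b c)

/-- **The reduction with the same-marking step.** -/
theorem C028At_of_stepSureSame (h : G.C028StepSureSame) :
    ∀ p : E → ℝ, IsProb p → ∀ a b c : V, G.C028At p a b c :=
  G.C028At_of_stepSure3 (G.C028StepSure3_of_same h)

/-- **A chosen edge** (mine-3 §12 (ii)): if every weight vector with a fractional edge has SOME
fractional edge at which the one-edge step holds for the marking at hand, C-028(c) holds everywhere. -/
def C028StepExists : Prop :=
  ∀ (p : E → ℝ) (a b c : V), IsProb p → fracEdges p ≠ ∅ →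
    ∃ e ∈ fracEdges p, G.C028At (Function.update p e 0) a b c →
      G.C028At (Function.update p e 1) a b c → G.C028At p a b c

/-- **The reduction to a chosen edge.** -/
theorem C028At_of_stepExists (h : G.C028StepExists) :
    ∀ p : E → ℝ, IsProb p → ∀ a b c : V, G.C028At p a b c := by
  suffices H : ∀ n : ℕ, ∀ p : E → ℝ, IsProb p → (fracEdges p).card = n →
      ∀ a b c : V, G.C028At p a b c by
    intro p hp
    exact H _ p hp rfl
  intro n
  refine Nat.strong_induction_on n ?_
  intro n ih p hp hn a b c
  by_cases hlive : fracEdges p = ∅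
  · exact G.C028At_of_isZeroOne (isZeroOne_of_fracEdges_eq_empty hlive) a b c
  · obtain ⟨e, he, hstep⟩ := h p a b c hp hlive
    exact hstep
      (ih _ (hn ▸ card_fracEdges_update_lt he (Or.inl rfl)) _ (hp.update e ⟨le_rfl, zero_le_one⟩)
        rfl a b c)
      (ih _ (hn ▸ card_fracEdges_update_lt he (Or.inr rfl)) _ (hp.update e ⟨zero_le_one, le_rfl⟩)
        rfl a b c)

/-- **C-026 from (A) at degree `≥ 3`.** -/
theorem C026At_of_stepSure3 {V E : Type} (G : MultiGraph V E) [Fintype E] [DecidableEq E]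
    (hA : G.C028StepSure3) : ∀ p : E → ℝ, IsProb p → ∀ a b c : V, G.C026At p a b c :=
  fun p hp a b c => G.C026At_of_C028At hp (G.C028At_of_stepSure3 hA p hp a b c)

end MultiGraph

end PercRepro
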